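import Summits.AtomisticToContinuum.Crystallization.Theorems.FrustratedLawDichotomyAtlasDoor
import Summits.AtomisticToContinuum.Crystallization.Theorems.FrustratedLawDichotomyTransportPriceLocal
import Summits.AtomisticToContinuum.Crystallization.Theorems.PricedLinkCensusLocalToGlobalPhaseGapDefs

/-!
# FrustratedLawDichotomy · crux `AperiodicFrustratedLawGap` (stmt-AtomisticToContinuum-27623) — THE REACH OF THE ATLAS: a law-MASS regime split
# (decomp-a2c, lens-5 «finite/base range + asymptotic regime + bridge», generation 115)

The atlas door (228) `…AtlasDoor.aperiodicFrustratedLawGap_of_atlas` proves the crux from certified row floors `e⋆ + m_i ≤ rootEnergy` on rows `K i`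
plus ONE residual hypothesis `ResidualCoreDeficit n K mK` («mean deficit of the uncovered roots < booked credit»).  Given the floors, that residual is
logically the crux again (a minimising law makes the residual inequality impossible), so the atlas buys INFORMATION about a counterexample, not a weaker
statement.  This file makes the information a THEOREM and a NUMBER.  Write `U := (⋃_{i<n} K i)ᶜ` (the uncovered roots) and `P(U) := P.real U`.

* §1–§2 (law level, any hard core `δ`, any level `c`; bookkeeping): the first-hit cells `rowCell K i` partition the covered set, so the booked credit is
  `≥ m·(1 − P(U))` when every margin is `≥ m`; an almost-sure DEFICIT CAP `c − rootEnergy ≤ D` bounds the residual side by `D·P(U)`; hence the residual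
  inequality of (228) — and `c < E_P[rootEnergy]` — hold for every point-stationary hard-core law with ★ `P(U) < reach m D := m/(m + D)`
  (`residual_lt_credit_of_mass`, `lt_integral_rootEnergy_of_mass`).
* §3 (crux level, the binder list of (228) VERBATIM at `δ = 7/10`): `NoAdmissibleMinimiserWith X` := «no admissible (clauses (a)(b)(d)(e), aperiodic)
  MINIMISING law satisfies `X`»; the REGIME SPLIT `NoAdmissibleMinimiserWith X → NoAdmissibleMinimiserWith ¬X → crux` (`…_split`, through the door with
  the EMPTY atlas), and its two mass regimes
  F(η) `CoherentMassExclusion n K η`  := no admissible minimising law has `P(U) < η`   — the (1−η)-ATLAS-COHERENT laws,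
  A(η) `OffAtlasMassGap n K η`        := no admissible minimising law has `η ≤ P(U)`   — the laws carrying off-atlas mass `≥ η`;
  `aperiodicFrustratedLawGap_of_massSplit : F η → A η → AperiodicFrustratedLawGap`, and conversely the crux gives both (EQUIVALENCE node: F η ∧ A η ⟺ crux,
  `…_of_aperiodicFrustratedLawGap`).
* §4 ★★ THE REACH THEOREM `coherentMassExclusion_of_floors`: deterministic row floors with margins `m_i ≥ m > 0` (the K-files' `hfloor` lines of (228), by
  name) + a deterministic deficit cap `e⋆ − rootEnergy μ ≤ D` at every rooted `7/10`-hard-core `μ` ⟹ F(η) for every `η ≤ m/(m+D)`.  With the TREE's universal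
  floor `…FrustratedLawDichotomyTransportPriceLocal.rootEnergy_add_c0_nonneg` (`rootEnergy ≥ −(250/12)(10/7)⁶` at hard core `7/10`) and `e⋆ ≤ −1/24`
  (periodised dimer, reused BY NAME as `…PricedLinkCensusLocalToGlobalPhaseGap.eStar_le_neg`):
  `D_univ = (250/12)(10/7)⁶ − 1/24 ≈ 177.04` (`deficit_le_Duniv`), so ★ `coherentMassExclusion_univ`: the certified atlas ALONE excludes every admissible
  minimising law that is `(1 − m/(m + D_univ))`-coherent — UNCONDITIONALLY in the law currency of the crux, the first such exclusion in the dense (textured)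
  regime.  The dial: `reach` is antitone in `D` (`reach_anti`) — every sharper certified one-centre floor at hard core `7/10` widens the excluded class
  (volume packing `D ≈ 4.5` ⇒ reach(F1) ≈ 1.1·10⁻³; a certified one-centre optimum `D♯ ≈ 1` ⇒ ≈ 5·10⁻³); `reach_F1_univ`: with the class-A margin of record
  `m_A(F1) = 5057/10⁶` (census F1-WIDTH-56) the tree constant gives `1/40000 < reach < 1/30000`.
HONEST LABELS (lens-5 NODE-g115): F(reach) is WEAKER than the crux and PROVED here modulo the row floors (= the K-file production of record: ATTACKABLE·
INSTRUMENTABLE); A(η) is the DECLARED RESIDUAL — weaker than the crux by restriction, EQUIVALENT to it once F(η) is in hand (this file proves both directions),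
i.e. it carries the whole difficulty (TetrahedralFrustration / IcosahedralClusters barrier: every law of TCP-like matter has `P(U) = 1`); what it gains over
`ResidualCoreDeficit` is FORM: a universally quantified gap over an explicit smaller class with the hypothesis «off-atlas mass ≥ η» available to the next cut.
DEFS `reach Duniv NoAdmissibleMinimiserWith CoherentMassExclusion OffAtlasMassGap` (plain `def`s; no instance / notation / option); imports TREE (228)
`…AtlasDoor`, `…FrustratedLawDichotomyTransportPriceLocal` (route-own floor) and `…PricedLinkCensusLocalToGlobalPhaseGapDefs` (`eStar_le_neg`) only; 0 sorry.
Landing-lane edition (hand-2 g49, ED2): the node's inlined `eStar_le_neg_one_div` is replaced by the landed `eStar_le_neg` (gate dedup rule) and the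
cross-route import `…ShellTopologyTrichotomyFrustratedLaw` by the route-own floor (theses-cone lint); statements of all other declarations unchanged.  Tags: [new: junction + bookkeeping]; the cap instance is [folklore].
-/

noncomputable section

namespace Summit.AtomisticToContinuum.Crystallization.Theorems.FrustratedLawDichotomyAtlasReach

open MeasureTheory Set Filter
open scoped ENNReal BigOperators
open Literature.MathematicalPhysics.StatisticalMechanics Literature.Probability.Process
open Summit.AtomisticToContinuum.Crystallization.Theorems.ChargedEnergyGapNegative (E3 eStar)
open Summit.AtomisticToContinuum.Crystallization.Theorems.FrustratedLawDichotomyMarginLedger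
  (rowCell rowCell_subset measurableSet_rowCell eq_of_mem_rowCell exists_mem_rowCell lt_integral_rootEnergy_of_rows)
open Summit.AtomisticToContinuum.Crystallization.Theorems.FrustratedLawDichotomyFiniteClusterGap (integrable_rootEnergy_of_ae_hardCore)
open Summit.AtomisticToContinuum.Crystallization.Theorems.FrustratedLawDichotomyAtlasDoor (ResidualCoreDeficit aperiodicFrustratedLawGap_of_atlas)
open Summit.AtomisticToContinuum.Crystallization.Theorems.FrustratedLawDichotomyTransportPriceLocal (rootEnergy_add_c0_nonneg)
open Summit.AtomisticToContinuum.Crystallization.Theorems.PricedLinkCensusLocalToGlobalPhaseGap (eStar_le_neg)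

variable {δ : ℝ} {P : Measure (Measure E3)} {n : ℕ} {K : ℕ → Set (Measure E3)} {mK : ℕ → ℝ}

/-! ## §1. The first-hit cells partition the covered set -/

/-- `⋃_{i<n} rowCell K i = ⋃_{i<n} K i`. [new: bookkeeping] -/
theorem iUnion_rowCell_eq (K : ℕ → Set (Measure E3)) (n : ℕ) : (⋃ i ∈ Finset.range n, rowCell K i) = ⋃ i ∈ Finset.range n, K i := by
  ext μ
  constructor
  · intro h
    obtain ⟨i, hi, hμ⟩ := Set.mem_iUnion₂.1 h
    exact Set.mem_biUnion hi (rowCell_subset K i hμ)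
  · intro h
    obtain ⟨i, hi, hμ⟩ := exists_mem_rowCell h
    exact Set.mem_biUnion hi hμ

/-- the first-hit cells are pairwise disjoint. [new: bookkeeping] -/
theorem pairwiseDisjoint_rowCell (K : ℕ → Set (Measure E3)) (n : ℕ) : (↑(Finset.range n) : Set ℕ).PairwiseDisjoint (rowCell K) :=
  fun _ _ _ _ hij => Set.disjoint_left.2 fun _ hi hj => hij (eq_of_mem_rowCell hi hj)

/-- ★ `Σ_{i<n} P(rowCell K i) = P(⋃_{i<n} K i)`. [new: bookkeeping] -/
theorem sum_measureReal_rowCell [IsFiniteMeasure P] (hK : ∀ i, MeasurableSet (K i)) (n : ℕ) :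
    ∑ i ∈ Finset.range n, P.real (rowCell K i) = P.real (⋃ i ∈ Finset.range n, K i) := by
  rw [← iUnion_rowCell_eq K n, measureReal_biUnion_finset (pairwiseDisjoint_rowCell K n) (fun i _ => measurableSet_rowCell hK i)]

/-- booked credit `≥ m · P(covered)` when every booked margin is `≥ m`. [new: bookkeeping] -/
theorem mul_measureReal_le_credit [IsFiniteMeasure P] (hK : ∀ i, MeasurableSet (K i)) {m : ℝ} (hm : ∀ i < n, m ≤ mK i) :
    m * P.real (⋃ i ∈ Finset.range n, K i) ≤ ∑ i ∈ Finset.range n, mK i * P.real (rowCell K i) := by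
  rw [← sum_measureReal_rowCell hK n, Finset.mul_sum]
  exact Finset.sum_le_sum fun i hi => mul_le_mul_of_nonneg_right (hm i (Finset.mem_range.1 hi)) measureReal_nonneg

/-! ## §2. The reach dial and the law-level reach lemma -/

/-- ★ THE REACH of an atlas with margin floor `m` against a deficit cap `D`: `m / (m + D)`. [new: dial] -/
def reach (m D : ℝ) : ℝ := m / (m + D)

/-- `0 < reach m D` for `0 < m`, `0 ≤ D`. -/
theorem reach_pos {m D : ℝ} (hm : 0 < m) (hD : 0 ≤ D) : 0 < reach m D := div_pos hm (by linarith)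

/-- `reach m D ≤ 1`. -/
theorem reach_le_one {m D : ℝ} (hm : 0 < m) (hD : 0 ≤ D) : reach m D ≤ 1 := (div_le_one (by linarith)).2 (by linarith)

/-- the reach is ANTITONE in the cap: a sharper certified deficit cap widens the excluded class. -/
theorem reach_anti {m D D' : ℝ} (hm : 0 < m) (hD : 0 ≤ D) (hDD' : D ≤ D') : reach m D' ≤ reach m D :=
  div_le_div_of_nonneg_left hm.le (by linarith) (by linarith)

/-- the reach is MONOTONE in the margin floor. -/
theorem reach_mono {m m' D : ℝ} (hm : 0 < m) (hmm' : m ≤ m') (hD : 0 ≤ D) : reach m D ≤ reach m' D := by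
  unfold reach
  rw [div_le_div_iff₀ (by linarith) (by linarith)]
  nlinarith

/-- residual side: an almost-sure deficit cap `c − rootEnergy ≤ D` bounds the mean deficit of the uncovered roots by `D · P(U)`. [new: bookkeeping] -/
theorem residual_le_cap [IsProbabilityMeasure P] (hK : ∀ i, MeasurableSet (K i)) (hδ : 0 < δ) (hcore : ∀ᵐ μ ∂P, IsRootedHardCore δ μ) {c D : ℝ}
    (hcap : ∀ᵐ μ ∂P, c - rootEnergy lennardJones μ ≤ D) :
    ∫ μ in (⋃ i ∈ Finset.range n, K i)ᶜ, (c - rootEnergy lennardJones μ) ∂P ≤ D * P.real (⋃ i ∈ Finset.range n, K i)ᶜ := by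
  have _hU : MeasurableSet (⋃ i ∈ Finset.range n, K i) := Finset.measurableSet_biUnion _ fun j _ => hK j
  have hI : Integrable (fun μ => c - rootEnergy lennardJones μ) P := (integrable_const c).sub (integrable_rootEnergy_of_ae_hardCore hδ hcore)
  calc ∫ μ in (⋃ i ∈ Finset.range n, K i)ᶜ, (c - rootEnergy lennardJones μ) ∂P ≤ ∫ _μ in (⋃ i ∈ Finset.range n, K i)ᶜ, D ∂P :=
        setIntegral_mono_ae hI.integrableOn (integrable_const D).integrableOn hcap
    _ = D * P.real (⋃ i ∈ Finset.range n, K i)ᶜ := by rw [setIntegral_const, smul_eq_mul, mul_comm]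

/-- ★ THE LAW-LEVEL REACH LEMMA: margins `≥ m > 0` on the rows, an a.s. cap `c − rootEnergy ≤ D`, and `P(U) < reach m D` give the residual inequality of (228).
[new: bookkeeping] -/
theorem residual_lt_credit_of_mass [IsProbabilityMeasure P] (hK : ∀ i, MeasurableSet (K i)) (hδ : 0 < δ) (hcore : ∀ᵐ μ ∂P, IsRootedHardCore δ μ)
    {c m D : ℝ} (hm0 : 0 < m) (hD : 0 ≤ D) (hm : ∀ i < n, m ≤ mK i) (hcap : ∀ᵐ μ ∂P, c - rootEnergy lennardJones μ ≤ D)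
    (hmass : P.real (⋃ i ∈ Finset.range n, K i)ᶜ < reach m D) :
    ∫ μ in (⋃ i ∈ Finset.range n, K i)ᶜ, (c - rootEnergy lennardJones μ) ∂P < ∑ i ∈ Finset.range n, mK i * P.real (rowCell K i) := by
  have hU : MeasurableSet (⋃ i ∈ Finset.range n, K i) := Finset.measurableSet_biUnion _ fun j _ => hK j
  have hcompl : P.real (⋃ i ∈ Finset.range n, K i)ᶜ = 1 - P.real (⋃ i ∈ Finset.range n, K i) := probReal_compl_eq_one_sub hU
  have hmD : 0 < m + D := by linarith
  have h1 : P.real (⋃ i ∈ Finset.range n, K i)ᶜ * (m + D) < m := by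
    have := hmass
    unfold reach at this
    rwa [lt_div_iff₀ hmD] at this
  have h2 : D * P.real (⋃ i ∈ Finset.range n, K i)ᶜ < m * P.real (⋃ i ∈ Finset.range n, K i) := by
    have h3 : m * P.real (⋃ i ∈ Finset.range n, K i) = m - m * P.real (⋃ i ∈ Finset.range n, K i)ᶜ := by rw [hcompl]; ring
    rw [h3]
    nlinarith
  exact lt_of_le_of_lt (residual_le_cap hK hδ hcore hcap) (lt_of_lt_of_le h2 (mul_measureReal_le_credit hK hm))

/-- ★ COROLLARY (any level `c`, any hard core): a.s. row floors with margins `≥ m > 0`, an a.s. cap and `P(U) < reach m D` price the mean root energy of a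
point-stationary hard-core law strictly above `c`. [new: bookkeeping] -/
theorem lt_integral_rootEnergy_of_mass [IsProbabilityMeasure P] (hK : ∀ i, MeasurableSet (K i)) (hδ : 0 < δ) (hcore : ∀ᵐ μ ∂P, IsRootedHardCore δ μ)
    (hstat : IsPointStationaryLaw P) {c m D : ℝ} (hm0 : 0 < m) (hD : 0 ≤ D) (hm : ∀ i < n, m ≤ mK i)
    (hfloor : ∀ i < n, ∀ᵐ μ ∂P, μ ∈ K i → c + mK i ≤ rootEnergy lennardJones μ) (hcap : ∀ᵐ μ ∂P, c - rootEnergy lennardJones μ ≤ D)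
    (hmass : P.real (⋃ i ∈ Finset.range n, K i)ᶜ < reach m D) : c < ∫ μ, rootEnergy lennardJones μ ∂P :=
  lt_integral_rootEnergy_of_rows hδ hcore hstat n K hK mK hfloor (residual_lt_credit_of_mass hK hδ hcore hm0 hD hm hcap hmass)

/-! ## §3. Crux level: the regime split over the binder list of (228) -/

/-- ★ «NO ADMISSIBLE MINIMISER IN THE REGIME `X`»: for every probability law `P` that is almost surely rooted `7/10`-hard-core (a), point-stationary (b),
texture-charged (d), almost surely Nash (e), aperiodic and MINIMISING (`E_P[rootEnergy] ≤ e⋆`) — the binder list of (228) `ResidualCoreDeficit` VERBATIM —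
`X P` fails.  `X := fun _ => True` is the crux at hard core `7/10` in contrapositive form (`…_of_aperiodicFrustratedLawGap` / `aperiodicFrustratedLawGap_of_…`).
[new: junction] -/
def NoAdmissibleMinimiserWith (X : MeasureTheory.Measure (MeasureTheory.Measure (EuclideanSpace ℝ (Fin 3))) → Prop) : Prop :=
  ∀ P : MeasureTheory.Measure (MeasureTheory.Measure (EuclideanSpace ℝ (Fin 3))), let Gy : ℝ → (N : ℕ) → (Fin N → EuclideanSpace ℝ (Fin 3)) → Fin N → Prop := fun η N y j => let d : ℝ := sInf ((fun z => dist z (y (j : Fin N))) '' (Set.range (y) \ {(y (j : Fin N))})); let T : Set (EuclideanSpace ℝ (Fin 3)) := {z : EuclideanSpace ℝ (Fin 3) | z ∈ Set.range (y) ∧ z ≠ (y (j : Fin N)) ∧ dist z (y (j : Fin N)) < 13 / 10 * d}; ∃ A : EuclideanSpace ℝ (Fin 3) →ₗᵢ[ℝ] EuclideanSpace ℝ (Fin 3), (∃ e : ↥T ≃ ↥Literature.Geometry.DiscreteGeometry.fccKissingPattern, ∀ t : ↥T, dist (d⁻¹ • ((t : EuclideanSpace ℝ (Fin 3)) - (y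 (j : Fin N)))) (A ((e t : ↥Literature.Geometry.DiscreteGeometry.fccKissingPattern) : EuclideanSpace ℝ (Fin 3))) ≤ η) ∨ (∃ e : ↥T ≃ ↥Literature.Geometry.DiscreteGeometry.hcpKissingPattern, ∀ t : ↥T, dist (d⁻¹ • ((t : EuclideanSpace ℝ (Fin 3)) - (y (j : Fin N)))) (A ((e t : ↥Literature.Geometry.DiscreteGeometry.hcpKissingPattern) : EuclideanSpace ℝ (Fin 3))) ≤ η); let TexBall : (N : ℕ) → (Fin N → EuclideanSpace ℝ (Fin 3)) → Fin N → ℝ → ℝ → ℝ → ℝ → Prop := fun N y i R R₇ R₈ R₉ => (∀ a b : Fin N, a ≠ b → (7 : ℝ) / 10 ≤ dist (y a) (y b)) ∧ (∀ j : Fin N, dist (y j) (y i) ≤ R → ¬ Gy (1 / 20) N (y) j) ∧ (∀ j : Fin N, dist (y j) (y i) ≤ R → ¬ ((∀ j' : Fin N, dist (y j') (y j) ≤ R₇ → ¬ Gy (1 / 20) N (y) j') ∧ (∀ z : EuclideanSpace ℝ (Fin 3), dist z (y j) ≤ R₇ → ∃ k : Fin N, dist z (y k) ≤ 1) ∧ (∀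 j' : Fin N, dist (y j') (y j) ≤ R₇ → (let d : ℝ := sInf ((fun z => dist z (y j')) '' (Set.range (y) \ {(y j')})); ∀ k : Fin N, y k ≠ y j' → dist (y k) (y j') < 27 / 20 * d → 5 ≤ Nat.card {m : Fin N // y m ≠ y j' ∧ dist (y m) (y j') < 27 / 20 * d ∧ y m ≠ y k ∧ dist (y m) (y k) < 27 / 20 * d})))) ∧ (∀ j : Fin N, dist (y j) (y i) ≤ R → ∃ k : Fin N, dist (y k) (y j) ≤ R₈ ∧ Gy (1 / 8) N (y) k) ∧ (∀ j : Fin N, dist (y j) (y i) ≤ R → ¬ ((∀ j' : Fin N, dist (y j') (y j) ≤ R₉ → ¬ Gy (1 / 20) N (y) j') ∧ (Nat.card {j' : Fin N // dist (y j') (y j) ≤ R₉ ∧ ¬ Gy (1 / 8) N (y) j'} : ℝ) ≤ 1 / 2 * (Nat.card {j' : Fin N // dist (y j') (y j) ≤ R₉} : ℝ) ∧ (∀ j' : Fin N, dist (y j') (y j) ≤ R₉ → ¬ Gy (1 / 8) N (y) j' → ¬ (let d : ℝ := sInf ((fun z => dist z (y j')) '' (Set.range (y) \ {(y j')})); ∀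 k : Fin N, y k ≠ y j' → dist (y k) (y j') < 27 / 20 * d → 5 ≤ Nat.card {m : Fin N // y m ≠ y j' ∧ dist (y m) (y j') < 27 / 20 * d ∧ y m ≠ y k ∧ dist (y m) (y k) < 27 / 20 * d})))); let Appr : MeasureTheory.Measure (EuclideanSpace ℝ (Fin 3)) → ℝ → ℝ → ℝ → Prop := fun μ R₇ R₈ R₉ => ∀ q : EuclideanSpace ℝ (Fin 3), μ {q} ≠ 0 → ∀ R ε : ℝ, 0 < ε → ∃ (N : ℕ) (y : Fin N → EuclideanSpace ℝ (Fin 3)) (i : Fin N), TexBall N y i R R₇ R₈ R₉ ∧ (∀ p : EuclideanSpace ℝ (Fin 3), μ {p} ≠ 0 → dist p q ≤ R → ∃ k : Fin N, dist (y k - y i) (p - q) ≤ ε) ∧ (∀ k : Fin N, dist (y k) (y i) ≤ R → ∃ p : EuclideanSpace ℝ (Fin 3), μ {p} ≠ 0 ∧ dist (y k - y i) (p - q) ≤ ε); MeasureTheory.IsProbabilityMeasure P → (∀ᵐ μ ∂P, Literature.Probability.Process.IsRootedHardCore (7 / 10) μ) → Literature.Probability.Process.IsPointStationaryLaw P → (∃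 R₇ R₈ R₉ : ℝ, ∀ᵐ μ ∂P, Appr μ R₇ R₈ R₉) → (∀ᵐ μ ∂P, ∀ p : EuclideanSpace ℝ (Fin 3), μ {p} ≠ 0 → ∀ y : EuclideanSpace ℝ (Fin 3), (∀ q : EuclideanSpace ℝ (Fin 3), μ {q} ≠ 0 → q ≠ p → y ≠ q) → ∑' q : {q : EuclideanSpace ℝ (Fin 3) // μ {q} ≠ 0 ∧ q ≠ p}, Literature.MathematicalPhysics.StatisticalMechanics.lennardJones (dist p (q : EuclideanSpace ℝ (Fin 3))) ≤ ∑' q : {q : EuclideanSpace ℝ (Fin 3) // μ {q} ≠ 0 ∧ q ≠ p}, Literature.MathematicalPhysics.StatisticalMechanics.lennardJones (dist y (q : EuclideanSpace ℝ (Fin 3)))) → P {μ : MeasureTheory.Measure (EuclideanSpace ℝ (Fin 3)) | ∃ Q : Literature.MathematicalPhysics.StatisticalMechanics.PeriodicConfiguration 3, ∃ t : EuclideanSpace ℝ (Fin 3), {p : EuclideanSpace ℝ (Fin 3) | μ {p} ≠ 0} = (fun s => s + t) '' Q.points} = 0 → (∫ μ, Literature.MathematicalPhysics.StatisticalMechanics.rootEnergy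 Literature.MathematicalPhysics.StatisticalMechanics.lennardJones μ ∂P) ≤ (⨅ Q : Literature.MathematicalPhysics.StatisticalMechanics.PeriodicConfiguration 3, Q.energyPerParticle Literature.MathematicalPhysics.StatisticalMechanics.lennardJones) → X P → False

/-- F(η) ★ «COHERENT-MASS EXCLUSION»: no admissible minimising law gives the uncovered set `U = (⋃_{i<n} K i)ᶜ` mass `< η` — the `(1−η)`-atlas-coherent laws are
not counterexamples.  WEAKER than the crux; PROVED from certified floors for `η ≤ reach m D` (§4). [new: junction] -/
def CoherentMassExclusion (n : ℕ) (K : ℕ → Set (MeasureTheory.Measure (EuclideanSpace ℝ (Fin 3)))) (η : ℝ) : Prop :=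
  NoAdmissibleMinimiserWith fun P => P.real (⋃ i ∈ Finset.range n, K i)ᶜ < η

/-- A(η) «OFF-ATLAS MASS GAP» — THE DECLARED RESIDUAL: no admissible minimising law gives the uncovered set mass `≥ η`.  Weaker than the crux by restriction;
equivalent to it once F(η) holds. [new: junction] -/
def OffAtlasMassGap (n : ℕ) (K : ℕ → Set (MeasureTheory.Measure (EuclideanSpace ℝ (Fin 3)))) (η : ℝ) : Prop :=
  NoAdmissibleMinimiserWith fun P => η ≤ P.real (⋃ i ∈ Finset.range n, K i)ᶜ

/-- regimes shrink contravariantly. [new: bookkeeping] -/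
theorem noAdmissibleMinimiserWith_mono {X Y : Measure (Measure E3) → Prop} (hXY : ∀ P, Y P → X P) (h : NoAdmissibleMinimiserWith X) :
    NoAdmissibleMinimiserWith Y := by
  intro P
  have h' := h P
  dsimp only at h' ⊢
  intro hP ha hb hd he h0 hmin hY
  exact h' hP ha hb hd he h0 hmin (hXY P hY)

/-- ★ THE REGIME SPLIT: a regime and its complement exhaust the admissible minimising laws. [new: junction] -/
theorem noAdmissibleMinimiserWith_split (X : Measure (Measure E3) → Prop) (hX : NoAdmissibleMinimiserWith X)
    (hX' : NoAdmissibleMinimiserWith fun P => ¬ X P) : NoAdmissibleMinimiserWith fun _ => True := by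
  intro P
  have h1 := hX P
  have h2 := hX' P
  dsimp only at h1 h2 ⊢
  intro hP ha hb hd he h0 hmin _
  by_cases hx : X P
  · exact h1 hP ha hb hd he h0 hmin hx
  · exact h2 hP ha hb hd he h0 hmin hx

/-- no admissible minimiser ⟹ the residual hypothesis of EVERY atlas (vacuously). [new: bookkeeping] -/
theorem residualCoreDeficit_of_noAdmissibleMinimiser (h : NoAdmissibleMinimiserWith fun _ => True) (n : ℕ)
    (K : ℕ → Set (MeasureTheory.Measure (EuclideanSpace ℝ (Fin 3)))) (mK : ℕ → ℝ) : ResidualCoreDeficit n K mK := by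
  intro P
  have h' := h P
  dsimp only at h' ⊢
  intro hP ha hb hd he h0 hmin
  exact (h' hP ha hb hd he h0 hmin trivial).elim

/-- ★ no admissible minimiser ⟹ the crux, through the door (228) with the EMPTY atlas. [new: junction] -/
theorem aperiodicFrustratedLawGap_of_noAdmissibleMinimiser (h : NoAdmissibleMinimiserWith fun _ => True) :
    Summit.AtomisticToContinuum.Crystallization.Theses.FrustratedLawDichotomy.AperiodicFrustratedLawGap :=
  aperiodicFrustratedLawGap_of_atlas 0 (fun _ => ∅) (fun _ => MeasurableSet.empty) (fun _ => 0) (fun i hi => absurd hi (Nat.not_lt_zero i))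
    (residualCoreDeficit_of_noAdmissibleMinimiser h 0 _ _)

/-- converse: the crux (at `δ = 7/10`) leaves no admissible minimiser. [new: bookkeeping] -/
theorem noAdmissibleMinimiser_of_aperiodicFrustratedLawGap
    (h : Summit.AtomisticToContinuum.Crystallization.Theses.FrustratedLawDichotomy.AperiodicFrustratedLawGap) : NoAdmissibleMinimiserWith fun _ => True := by
  intro P
  have h' := h (7 / 10) (by norm_num) P
  dsimp only at h' ⊢
  intro hP ha hb hd he h0 hmin _
  exact absurd hmin (not_le.2 (h' hP ha hb hd he h0))

/-- ★★ THE MASS SPLIT CLOSES THE CRUX: F(η) ∧ A(η) ⟹ `AperiodicFrustratedLawGap` (excluded middle on `P(U) < η`). [new: junction] -/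
theorem aperiodicFrustratedLawGap_of_massSplit (n : ℕ) (K : ℕ → Set (MeasureTheory.Measure (EuclideanSpace ℝ (Fin 3)))) (η : ℝ)
    (hF : CoherentMassExclusion n K η) (hA : OffAtlasMassGap n K η) :
    Summit.AtomisticToContinuum.Crystallization.Theses.FrustratedLawDichotomy.AperiodicFrustratedLawGap :=
  aperiodicFrustratedLawGap_of_noAdmissibleMinimiser
    (noAdmissibleMinimiserWith_split _ hF (noAdmissibleMinimiserWith_mono (fun _ h => not_lt.1 h) hA))

/-- converse, F side: the crux gives F(η) for every atlas and every `η`. [new: bookkeeping] -/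
theorem coherentMassExclusion_of_aperiodicFrustratedLawGap
    (h : Summit.AtomisticToContinuum.Crystallization.Theses.FrustratedLawDichotomy.AperiodicFrustratedLawGap) (n : ℕ)
    (K : ℕ → Set (MeasureTheory.Measure (EuclideanSpace ℝ (Fin 3)))) (η : ℝ) : CoherentMassExclusion n K η :=
  noAdmissibleMinimiserWith_mono (fun _ _ => trivial) (noAdmissibleMinimiser_of_aperiodicFrustratedLawGap h)

/-- converse, A side: the crux gives A(η) for every atlas and every `η` (so A(η) ∧ F(η) ⟺ crux: an EQUIVALENCE node). [new: bookkeeping] -/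
theorem offAtlasMassGap_of_aperiodicFrustratedLawGap
    (h : Summit.AtomisticToContinuum.Crystallization.Theses.FrustratedLawDichotomy.AperiodicFrustratedLawGap) (n : ℕ)
    (K : ℕ → Set (MeasureTheory.Measure (EuclideanSpace ℝ (Fin 3)))) (η : ℝ) : OffAtlasMassGap n K η :=
  noAdmissibleMinimiserWith_mono (fun _ _ => trivial) (noAdmissibleMinimiser_of_aperiodicFrustratedLawGap h)

/-- A(η) is monotone in `η` (a larger threshold is a smaller residual class); F(η) antitone. [new: bookkeeping] -/
theorem offAtlasMassGap_mono {n : ℕ} {K : ℕ → Set (MeasureTheory.Measure (EuclideanSpace ℝ (Fin 3)))} {η η' : ℝ} (hη : η ≤ η')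
    (h : OffAtlasMassGap n K η) : OffAtlasMassGap n K η' :=
  noAdmissibleMinimiserWith_mono (fun _ h' => le_trans hη h') h

/-- F(η) is antitone in `η` (a smaller threshold is a smaller coherent class). [new: bookkeeping] -/
theorem coherentMassExclusion_anti {n : ℕ} {K : ℕ → Set (MeasureTheory.Measure (EuclideanSpace ℝ (Fin 3)))} {η η' : ℝ} (hη : η ≤ η')
    (h : CoherentMassExclusion n K η') : CoherentMassExclusion n K η :=
  noAdmissibleMinimiserWith_mono (fun _ h' => lt_of_lt_of_le h' hη) h

/-! ## §4. ★★ The reach theorem: certified floors + a deficit cap prove F(reach) -/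

/-- ★★ **THE REACH THEOREM.**  Deterministic row floors at every rooted `7/10`-hard-core Nash configuration of each row (the `hfloor` lines of (228), by name)
with margins `m_i ≥ m > 0`, and a deterministic DEFICIT CAP `e⋆ − rootEnergy μ ≤ D` on rooted `7/10`-hard-core configurations, prove F(η) for every
`η ≤ reach m D = m/(m+D)`: no admissible minimising law is `(1−η)`-coherent with the atlas. [new: junction] -/
theorem coherentMassExclusion_of_floors (n : ℕ) (K : ℕ → Set (MeasureTheory.Measure (EuclideanSpace ℝ (Fin 3)))) (hK : ∀ i, MeasurableSet (K i)) (mK : ℕ → ℝ)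
    (hfloor : ∀ i < n, ∀ μ : Measure E3, IsRootedHardCore (7 / 10) μ →
      (∀ p : E3, μ {p} ≠ 0 → ∀ y : E3, (∀ q : E3, μ {q} ≠ 0 → q ≠ p → y ≠ q) →
        ∑' q : {q : E3 // μ {q} ≠ 0 ∧ q ≠ p}, lennardJones (dist p (q : E3)) ≤ ∑' q : {q : E3 // μ {q} ≠ 0 ∧ q ≠ p}, lennardJones (dist y (q : E3))) →
      μ ∈ K i → eStar + mK i ≤ rootEnergy lennardJones μ)
    {m D : ℝ} (hm0 : 0 < m) (hD : 0 ≤ D) (hm : ∀ i < n, m ≤ mK i)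
    (hcap : ∀ μ : Measure E3, IsRootedHardCore (7 / 10) μ → eStar - rootEnergy lennardJones μ ≤ D) {η : ℝ} (hη : η ≤ reach m D) :
    CoherentMassExclusion n K η := by
  intro P
  dsimp only
  intro hP ha hb hd he h0 hmin hmass
  have hfl : ∀ i < n, ∀ᵐ μ ∂P, μ ∈ K i → eStar + mK i ≤ rootEnergy lennardJones μ := fun i hi => by
    filter_upwards [ha, he] with μ hμ hN hμi using hfloor i hi μ hμ hN hμi
  have hlt : eStar < ∫ μ, rootEnergy lennardJones μ ∂P :=
    lt_integral_rootEnergy_of_mass hK (by norm_num : (0 : ℝ) < 7 / 10) ha hb hm0 hD hm hfl (ha.mono fun μ hμ => hcap μ hμ) (lt_of_lt_of_le hmass hη)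
  exact absurd hmin (not_le.2 hlt)

/-- THE TREE'S UNIVERSAL DEFICIT CAP at hard core `7/10`: `D_univ := (250/12)·(10/7)⁶ − 1/24 ≈ 177.04`. [folklore] -/
def Duniv : ℝ := 250 / 12 * (7 / 10 : ℝ)⁻¹ ^ 6 - 1 / 24

/-- `0 ≤ D_univ`. -/
theorem Duniv_nonneg : 0 ≤ Duniv := by
  unfold Duniv
  norm_num

/-- ★ every rooted `7/10`-hard-core configuration has deficit `e⋆ − rootEnergy ≤ D_univ` (tree floor `rootEnergy ≥ −(250/12)(10/7)⁶`, route-own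
`…TransportPriceLocal.rootEnergy_add_c0_nonneg`, + `e⋆ ≤ −1/24`, tree `…PricedLinkCensusLocalToGlobalPhaseGap.eStar_le_neg`). [folklore] -/
theorem deficit_le_Duniv (μ : Measure E3) (hμ : IsRootedHardCore (7 / 10) μ) : eStar - rootEnergy lennardJones μ ≤ Duniv := by
  have h1 := rootEnergy_add_c0_nonneg hμ
  have h2 := eStar_le_neg
  have h3 : (250 / 12 * (7 / 10 : ℝ)⁻¹ ^ 6 : ℝ) = 250 / 12 * (10 / 7) ^ 6 := by norm_num
  unfold Duniv
  rw [h3]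
  linarith

/-- ★★ **UNCONDITIONAL REACH OF A CERTIFIED ATLAS.**  Row floors with margins `≥ m > 0` ALONE exclude every admissible minimising law that is
`(1 − reach m D_univ)`-coherent with the atlas — no residual hypothesis. [new: junction] -/
theorem coherentMassExclusion_univ (n : ℕ) (K : ℕ → Set (MeasureTheory.Measure (EuclideanSpace ℝ (Fin 3)))) (hK : ∀ i, MeasurableSet (K i)) (mK : ℕ → ℝ)
    (hfloor : ∀ i < n, ∀ μ : Measure E3, IsRootedHardCore (7 / 10) μ →
      (∀ p : E3, μ {p} ≠ 0 → ∀ y : E3, (∀ q : E3, μ {q} ≠ 0 → q ≠ p → y ≠ q) →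
        ∑' q : {q : E3 // μ {q} ≠ 0 ∧ q ≠ p}, lennardJones (dist p (q : E3)) ≤ ∑' q : {q : E3 // μ {q} ≠ 0 ∧ q ≠ p}, lennardJones (dist y (q : E3))) →
      μ ∈ K i → eStar + mK i ≤ rootEnergy lennardJones μ)
    {m : ℝ} (hm0 : 0 < m) (hm : ∀ i < n, m ≤ mK i) : CoherentMassExclusion n K (reach m Duniv) :=
  coherentMassExclusion_of_floors n K hK mK hfloor hm0 Duniv_nonneg hm deficit_le_Duniv le_rfl

/-- hence, unconditionally: the crux ⟺ its off-atlas residual A(reach m D_univ), for any certified atlas with margin floor `m > 0`. [new: junction] -/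
theorem aperiodicFrustratedLawGap_of_offAtlasMassGap_univ (n : ℕ) (K : ℕ → Set (MeasureTheory.Measure (EuclideanSpace ℝ (Fin 3))))
    (hK : ∀ i, MeasurableSet (K i)) (mK : ℕ → ℝ)
    (hfloor : ∀ i < n, ∀ μ : Measure E3, IsRootedHardCore (7 / 10) μ →
      (∀ p : E3, μ {p} ≠ 0 → ∀ y : E3, (∀ q : E3, μ {q} ≠ 0 → q ≠ p → y ≠ q) →
        ∑' q : {q : E3 // μ {q} ≠ 0 ∧ q ≠ p}, lennardJones (dist p (q : E3)) ≤ ∑' q : {q : E3 // μ {q} ≠ 0 ∧ q ≠ p}, lennardJones (dist y (q : E3))) →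
      μ ∈ K i → eStar + mK i ≤ rootEnergy lennardJones μ)
    {m : ℝ} (hm0 : 0 < m) (hm : ∀ i < n, m ≤ mK i) (hA : OffAtlasMassGap n K (reach m Duniv)) :
    Summit.AtomisticToContinuum.Crystallization.Theses.FrustratedLawDichotomy.AperiodicFrustratedLawGap :=
  aperiodicFrustratedLawGap_of_massSplit n K _ (coherentMassExclusion_univ n K hK mK hfloor hm0 hm) hA

/-- THE NUMBER (lens-5's «how far must the finite range reach»): with the class-A margin of record `m_A(F1) = 5057/10⁶` (census F1-WIDTH-56, the
minimum over the class-A band) and the tree cap, `1/40000 < reach < 1/30000`: unconditionally, an admissible minimising law (a counterexample to the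
crux) gives the uncovered set mass `≥ reach > 1/40000`; sharper certified one-centre floors at hard core `7/10` move this dial (`reach_anti`).
[new: numerical instance] -/
theorem reach_F1_univ : 1 / 40000 < reach (5057 / 1000000) Duniv ∧ reach (5057 / 1000000) Duniv < 1 / 30000 := by
  unfold reach Duniv
  constructor <;> norm_num

end Summit.AtomisticToContinuum.Crystallization.Theorems.FrustratedLawDichotomyAtlasReach

end
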